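import Mathlib

/-!
# Route `GaussianLinkFrames` (QCD sub-problem), support `PlaquetteGaussianFrame` (stmt-QuantumFields-17376) — engine:
# Gaussian integrals over `M₃(ℂ) ≅ ℝ¹⁸` with a real-linear source

* `integral_cexp_gaussian_source` / `integral_rexp_gaussian_source`: `∫_ℂ e^{−a|z|² + 2 Re(z·conj m)} dz = (π/a)·e^{|m|²/a}` (`a > 0`), from
  Mathlib's `integral_cexp_neg_mul_sq_norm_add` on the real inner product space `ℂ` (`finrank = 2`, `⟪m, z⟫_ℝ = Re(z·conj m)`).
* `integral_matrix_gaussian_source`: `∫_{M₃(ℂ)} e^{−a·Re tr(XᴴX) + 2·Re tr(XᴴM)} dX = (π/a)⁹·e^{Re tr(MᴴM)/a}`, coordinatewise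
  (`Re tr(XᴴX) = Σ|X_{ij}|²`, `Re tr(XᴴM) = Σ Re(M_{ij}·conj X_{ij})`) by `integral_fintype_prod_volume_eq_prod` twice.
Pure Gaussian calculus; no QCD / Yang–Mills statement is proved here.  Cell `ym-idea-1`, LEAD seat `ym-line-sfw-p2` g71 (free hands),
`--supports stmt-QuantumFields-17376`.
References: H. Vairinhos, P. de Forcrand, JHEP 12 (2014) 038 [VairinhosDeforcrand2014] (auxiliary-field representation). [folklore]
-/

set_option autoImplicit false

noncomputable section

open MeasureTheory Complex
open scoped ComplexConjugate Matrix RealInnerProductSpace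

namespace Summit.QuantumFields.QCD.Theorems.GaussianLinkFramesMatrixGaussian

/-! ## §1 One complex variable -/

/-- `∫_ℂ cexp(−a|z|² + 2⟪m,z⟫_ℝ) = (π/a)·cexp(|m|²/a)` for real `a > 0` (Mathlib's Gaussian-with-source on the 2-dimensional real inner
product space `ℂ`). [folklore] -/
theorem integral_cexp_gaussian_source {a : ℝ} (ha : 0 < a) (m : ℂ) :
    ∫ z : ℂ, cexp (-(a : ℂ) * (‖z‖ : ℂ) ^ 2 + (2 : ℂ) * (inner ℝ m z : ℝ)) =
      (Real.pi / a : ℂ) * cexp ((‖m‖ ^ 2 / a : ℝ) : ℂ) := by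
  have hb : 0 < ((a : ℂ)).re := by simpa using ha
  have h := GaussianFourier.integral_cexp_neg_mul_sq_norm_add hb (2 : ℂ) m
  rw [Complex.finrank_real_complex] at h
  rw [h]
  have h1 : ((Real.pi : ℂ) / (a : ℂ)) ^ ((2 : ℕ) / 2 : ℂ) = (Real.pi / a : ℂ) := by
    rw [show ((2 : ℕ) / 2 : ℂ) = (1 : ℂ) by norm_num, cpow_one]
  have h2 : (2 : ℂ) ^ 2 * (‖m‖ : ℂ) ^ 2 / (4 * (a : ℂ)) = ((‖m‖ ^ 2 / a : ℝ) : ℂ) := by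
    push_cast
    have ha0 : (a : ℂ) ≠ 0 := by exact_mod_cast ha.ne'
    field_simp
    ring
  rw [h1, h2]

/-- `∫_ℂ e^{−a|z|² + 2 Re(z·conj m)} dz = (π/a)·e^{|m|²/a}` for real `a > 0` (real form; `⟪m, z⟫_ℝ = Re(z·conj m)`). [folklore] -/
theorem integral_rexp_gaussian_source {a : ℝ} (ha : 0 < a) (m : ℂ) :
    ∫ z : ℂ, Real.exp (-a * ‖z‖ ^ 2 + 2 * (z * conj m).re) = Real.pi / a * Real.exp (‖m‖ ^ 2 / a) := by
  rw [← Complex.ofReal_inj]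
  have h := integral_cexp_gaussian_source ha m
  push_cast at h ⊢
  rw [← h, ← integral_complex_ofReal]
  refine integral_congr_ae (Filter.Eventually.of_forall fun z => ?_)
  simp only [Complex.ofReal_exp, Complex.inner m z]
  push_cast
  ring_nf

/-! ## §2 The matrix Gaussian with a real-linear source -/

/-- `Re tr(XᴴX) = Σ_{i,j} |X j i|²`. [folklore] -/
theorem re_trace_conjTranspose_mul_self {n : ℕ} (X : Matrix (Fin n) (Fin n) ℂ) :
    (Xᴴ * X).trace.re = ∑ i, ∑ j, ‖X j i‖ ^ 2 := by
  simp only [Matrix.trace, Matrix.diag, Matrix.mul_apply, Matrix.conjTranspose_apply, Complex.re_sum]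
  refine Finset.sum_congr rfl fun i _ => Finset.sum_congr rfl fun j _ => ?_
  rw [Complex.star_def, Complex.conj_mul', ← Complex.ofReal_pow, Complex.ofReal_re]

/-- `Re tr(XᴴM) = Σ_{i,j} Re(M j i · conj (X j i))`. [folklore] -/
theorem re_trace_conjTranspose_mul {n : ℕ} (X M : Matrix (Fin n) (Fin n) ℂ) :
    (Xᴴ * M).trace.re = ∑ i, ∑ j, (X j i * conj (M j i)).re := by
  simp only [Matrix.trace, Matrix.diag, Matrix.mul_apply, Matrix.conjTranspose_apply, Complex.re_sum]
  refine Finset.sum_congr rfl fun i _ => Finset.sum_congr rfl fun j _ => ?_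
  rw [Complex.star_def]
  have : (starRingEnd ℂ) (X j i) * M j i = conj (X j i * conj (M j i)) := by simp [mul_comm]
  rw [this, Complex.conj_re]

/-- **THE MATRIX GAUSSIAN WITH A REAL-LINEAR SOURCE**: for real `a > 0` and `M ∈ Mₙ(ℂ)`,
`∫_{Mₙ(ℂ)} e^{−a·Re tr(XᴴX) + 2·Re tr(XᴴM)} dX = (π/a)^{n²}·e^{Re tr(MᴴM)/a}` (volume on `Fin n → Fin n → ℂ` = Lebesgue on `ℝ^{2n²}`),
coordinatewise from §1 by `integral_fintype_prod_volume_eq_prod` (twice). [folklore] -/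
theorem integral_matrix_gaussian_source {n : ℕ} {a : ℝ} (ha : 0 < a) (M : Matrix (Fin n) (Fin n) ℂ) :
    ∫ X : Fin n → Fin n → ℂ, Real.exp (-a * ((Matrix.of X)ᴴ * Matrix.of X).trace.re + 2 * ((Matrix.of X)ᴴ * M).trace.re) =
      (Real.pi / a) ^ (n * n) * Real.exp ((Mᴴ * M).trace.re / a) := by
  -- rewrite the integrand as a product over the entries
  have hint : ∀ X : Fin n → Fin n → ℂ,
      Real.exp (-a * ((Matrix.of X)ᴴ * Matrix.of X).trace.re + 2 * ((Matrix.of X)ᴴ * M).trace.re) =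
        ∏ j, ∏ i, Real.exp (-a * ‖X j i‖ ^ 2 + 2 * (X j i * conj (M j i)).re) := by
    intro X
    rw [re_trace_conjTranspose_mul_self, re_trace_conjTranspose_mul, Finset.mul_sum, Finset.mul_sum, ← Finset.sum_add_distrib]
    simp_rw [Finset.mul_sum, ← Finset.sum_add_distrib]
    rw [Finset.sum_comm, Real.exp_sum]
    refine Finset.prod_congr rfl fun j _ => ?_
    rw [Real.exp_sum]
    rfl
  simp_rw [hint]
  have hrow : ∀ j : Fin n, (∫ row : Fin n → ℂ, ∏ i, Real.exp (-a * ‖row i‖ ^ 2 + 2 * (row i * conj (M j i)).re)) =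
      ∏ i, (Real.pi / a * Real.exp (‖M j i‖ ^ 2 / a)) := by
    intro j
    rw [integral_fintype_prod_volume_eq_prod
      (fun i (z : ℂ) => Real.exp (-a * ‖z‖ ^ 2 + 2 * (z * conj (M j i)).re))]
    exact Finset.prod_congr rfl fun i _ => integral_rexp_gaussian_source ha (M j i)
  rw [integral_fintype_prod_volume_eq_prod
    (fun j (row : Fin n → ℂ) => ∏ i, Real.exp (-a * ‖row i‖ ^ 2 + 2 * (row i * conj (M j i)).re))]
  simp_rw [hrow]
  -- collect the product
  rw [re_trace_conjTranspose_mul_self M]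
  calc ∏ j, ∏ i, (Real.pi / a * Real.exp (‖M j i‖ ^ 2 / a))
      = ∏ j, ((Real.pi / a) ^ n * Real.exp (∑ i, ‖M j i‖ ^ 2 / a)) := by
        refine Finset.prod_congr rfl fun j _ => ?_
        rw [Finset.prod_mul_distrib, Finset.prod_const, Finset.card_univ, Fintype.card_fin, Real.exp_sum]
    _ = (Real.pi / a) ^ (n * n) * Real.exp (∑ j, ∑ i, ‖M j i‖ ^ 2 / a) := by
        rw [Finset.prod_mul_distrib, Finset.prod_const, Finset.card_univ, Fintype.card_fin, ← pow_mul, Real.exp_sum]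
    _ = (Real.pi / a) ^ (n * n) * Real.exp ((∑ i, ∑ j, ‖M j i‖ ^ 2) / a) := by
        rw [Finset.sum_comm, Finset.sum_div]
        simp_rw [Finset.sum_div]

end Summit.QuantumFields.QCD.Theorems.GaussianLinkFramesMatrixGaussian

end
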